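import Summits.BirchSwinnertonDyer.BirchSwinnertonDyer.Theorems.EisensteinPrimesMazurMCOnX1RankZeroCongruenceRoadMuPart
import Literature.NumberTheory.EllipticCurves.CyclotomicIwasawaMainTheoremIrreducibleProofs
import HarnessLib

/-!
# Crux `MazurMCOnCellB` (stmt-BirchSwinnertonDyer-19033), line `mudescent`, stub
# `stub_analyticMuZero_offLocus`: the CONGRUENCE ROAD at `p ‖ N`, SHARPENED — an `E[p]`-congruent
# partner with `μ′_an = 0` buys exactly Greenberg's `μ = 0` at the X2b étale end, and under the crux
# the road's transfer holds (cell `bsd-eis`, seat `bsd-eis-mu-c` g2, PROGRAMME PART 1b seat (3);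
# NEGATIVE-expected probe — closes NO stub; route-INDEPENDENT imports, no `Theses` cone)

The X2b twin of `EisensteinPrimesMazurMCOnX1RankZeroCongruenceRoadMuPart.lean`. The predecessor files
of this seat (g0: p458043, p459547) typed the road to the open stub
`X2.CellB W₀ p → ¬ HasRamifiedOddLineAt W₀ p → X2.AnalyticMuLE W₀ p 0` as stub ⇐ (T) ∧ (S) with (T)
«`E[p] ≅ E′[p]` transports the Néron-normalised analytic `μ = 0` among multiplicative reducible pairs»
UNPRINTED. The tree holds the ALGEBRAIC transfer at `p ‖ N` in both directions
(`X2.CongruentLambdaShiftMultiplicative.mu_eq_zero_mult_of_mult`, `…mu_eq_zero_mult_of_goodOrd`; GV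
p. 27, Tate uniformisation, GV (5)–(7)/Prop. (2.5)/p. 15 as named facts, Kato cotorsion) and the
Kato–Wuthrich reading `μ_an = 0 ⇒ μ(X(E/ℚ_∞)) = 0` at `p ‖ N`
(`X2.isTorsion_and_mu_eq_zero_of_analyticMuLE_zero`).

WHAT THIS FILE PROVES (theorems only; no `def`, no named fact, no `sorry`):
* §1 THE PARTNER BUYS (G): a multiplicative (resp. good-ordinary) `V` with `W₀[p] ≅ V[p]` and the
  certificate `X2.AnalyticMuLE V p 0` (resp. `X1.MuPart.AnalyticMuLE V p 0`) gives, for every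
  cyclotomic dual datum of the multiplicative reducible `W₀`: `X(W₀/ℚ_∞)` torsion and `μ = 0`
  (`forall_isTorsion_and_mu_eq_zero_of_torsionIso_mult`, `…_goodOrd`).
* §2 UNDER MAZUR'S MAIN CONJECTURE AT `(W,p)` (`X2.MazurMainConjectureAt`, the crux's conclusion
  predicate), `μ_an = 0 ⟺ μ(X(W/ℚ_∞)) = 0` (`analyticMuLE_zero_iff_forall_mu_eq_zero_of_mazurMainConjectureAt`;
  ⇐ needs no divisibility fact: the generator is nonzero, `μ(T) = μ(unit) = 0`, unit content). So the
  μ-part of the road's hypothesis (T) is carried by the crux and the Greenberg part by §1: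
  `transfer_of_mazurMCOnCellB` — under the crux (stated WITHOUT importing the route file) the road's
  transfer (T) holds at every X2b target, for partners of either reduction type.
* §3 THE STUB UNDER THE CRUX: `stub ⇐ crux ∧ (S″)` with (S″) = every off-locus X2b curve has an
  `E[p]`-congruent partner (multiplicative OR good ordinary) carrying `μ_an = 0`
  (`stub_of_mazurMCOnCellB_of_partnerSupply`); the stub supplies its own partner
  (`partnerSupply_of_stub`). At `p ‖ N` the converse decomposition «stub ⟺ (S″) ∧ (μ-part)» of the
  X1 twin would need the non-vanishing of the Mazur–Tate–Teitelbaum function, which the tree does not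
  hold as a theorem; it is not claimed here.

HONEST FRAMING: a PROBE; nothing here proves or refutes the stub or the crux; hypotheses are
PUBLISHED named facts only (`hW16`, `hWu`, `hmod`, `hT`, `hT'`, `hAm`, `hBm`, `hF`, `hGV`, `hA`,
`hB`), as in the tree's route-G files. What a «computed `μ′ = 0` at a congruent curve» buys on row
A10 is exactly Greenberg's algebraic `μ = 0` at `W₀` (§1); the remaining content of the road is the
crux's own (§2). References: [GreenbergVatsal2000] Thm. (1.4), §2 Prop. (2.8), pp. 14–15, 26–27;
[GreenbergLNM1716] Conj. 1.11, p. 132; [Wuthrich2014] Thm. 16; [MazurTateTeitelbaum1986] §I.14;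
HOME `run/shared/lean/pub/bsd-eis/mu-c-MEMO-1.md` ADDENDUM 3.
-/

set_option autoImplicit false

-- `Summit.BirchSwinnertonDyer.BirchSwinnertonDyer.…`: the summit and its single sub-problem share a name (D-0017 layout).
set_option linter.dupNamespace false

noncomputable section

open scoped Classical MatrixGroups ModularForm

open CongruenceSubgroup WeierstrassCurve NumberField IsDedekindDomain
  Literature.NumberTheory.EllipticCurves Literature.NumberTheory.EllipticCurves.ModularForms
  Literature.NumberTheory.EllipticCurves.Rank1Residual
  Literature.NumberTheory.EllipticCurves.GreenbergVatsal2000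
  Literature.Barriers.BirchSwinnertonDyer
  Summit.BirchSwinnertonDyer.Rank1Residual
  Summit.BirchSwinnertonDyer.Rank1Residual.X1.CongruenceTransfer
  Summit.BirchSwinnertonDyer.Rank1Residual.X1.MuLambda
  Summit.BirchSwinnertonDyer.Rank1Residual.X1.MuPart
  Summit.BirchSwinnertonDyer.Rank1Residual.X1.MuStructure
  Summit.BirchSwinnertonDyer.BirchSwinnertonDyer.Theorems
  Summit.BirchSwinnertonDyer.BirchSwinnertonDyer.Theorems.EisensteinPrimesMazurMCOnX1RankZeroCongruenceRoadMuPart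

namespace Summit.BirchSwinnertonDyer.BirchSwinnertonDyer.Theorems.EisensteinPrimesMazurMCOnCellBCongruenceRoadMuPart

variable {W₀ V : WeierstrassCurve ℚ} [W₀.IsElliptic] [W₀.IsGloballyMinimal] [V.IsElliptic]
  [V.IsGloballyMinimal] {p : ℕ} [hp : Fact p.Prime]

/-! ## §1 The partner's certificate buys `X(W₀/ℚ_∞)` torsion with `μ = 0` at a multiplicative `W₀` -/

/-- **A MULTIPLICATIVE congruent partner with `μ′_an = 0` gives `μ(X(W₀/ℚ_∞)) = 0`** (mult–mult;
by the predecessor file p458043 such a partner of an X2b curve is X2b again, of the same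
splitness). `W₀` multiplicative at the odd `p` with `W₀[p]` reducible, `V` multiplicative at `p`,
`TorsionIso W₀ V p`, `X2.AnalyticMuLE V p 0`. Then every cyclotomic dual datum `D` of `W₀` is torsion
with `D.mu = 0`: Kato–Wuthrich at `V` (`X2.isTorsion_and_mu_eq_zero_of_analyticMuLE_zero`), Wuthrich's
torsion at `W₀`, and the tree's transfer `mu_eq_zero_mult_of_mult` from `V` to `W₀`. Inputs by name:
Wuthrich Thm. 16 at `p ‖ N` (`hWu`), modularity (`hmod`), Tate uniformisation (`hT`, `hT'`), GV
(5)–(7) at `p ‖ N` (`hAm`), GV Prop. (2.5) (`hBm`), GV p. 15 (`hF`).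
[cite: GreenbergVatsal2000, Thm. (1.4), §2 Prop. (2.8) and pp. 26–27] [cite: Wuthrich2014, Thm. 16 (p. 397)]
[cite: GreenbergLNM1716, p. 132 and Conj. 1.11] -/
theorem forall_isTorsion_and_mu_eq_zero_of_torsionIso_mult
    (hWu : Wuthrich2014.thm16_charIdeal_dvd_multiplicative_of_reducible)
    (hmod : nonempty_modularParametrizationData)
    (hT : Silverman1994_thmV53_corV54_tateUniformisation.{0})
    (hT' : Silverman1994_thmV53_tateUniformisation.{0})
    (hAm : lambda_nonPrimitive_eq_add_sum_delta_multiplicative)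
    (hBm : datumSelmer_divisible_of_finite_torsionBy) (hF : datumStrictSelmer_lt_datumSelmer_of_split)
    (hp2 : p ≠ 2) (hmult₀ : W₀.HasMultiplicativeReductionAtPrime p)
    (hred₀ : ¬ W₀.HasIrreducibleModPGaloisRep p) (hmultV : V.HasMultiplicativeReductionAtPrime p)
    (hiso : TorsionIso W₀ V p) (hV : X2.AnalyticMuLE V p 0)
    {κ : ZpExtension ℚ p} {γ : Field.absoluteGaloisGroup ℚ}
    (hκ : κ.IsCyclotomic) (hγ : κ.IsTopGenerator γ) (hγ' : IsCyclotomicVariable p γ)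
    (D : W₀.SelmerDualData κ γ) : D.IsTorsion ∧ D.mu = 0 := by
  haveI : NeZero (W₀.conductorNorm ℤ) := ⟨(W₀.conductorNorm_pos_holds).ne'⟩
  have hredV : ¬ V.HasIrreducibleModPGaloisRep p := by
    intro hirr
    obtain ⟨e, he⟩ := hiso.symm
    exact hred₀ (hasIrreducibleModPGaloisRep_of_torsionIso e he hirr)
  obtain ⟨DV⟩ := V.nonempty_selmerDualData_holds κ γ hγ
  haveI : Module.Finite (IwasawaAlgebra p) D.X := D.module_finite_holds hγ
  haveI : Module.Finite (IwasawaAlgebra p) DV.X := DV.module_finite_holds hγ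
  obtain ⟨hXV, hμV⟩ := X2.isTorsion_and_mu_eq_zero_of_analyticMuLE_zero hWu hmod hp2 hmultV hredV hV
    hκ hγ hγ' DV
  obtain ⟨Dm⟩ := hmod W₀
  obtain ⟨ϖ, -, hϖ, -⟩ := Dm.exists_rat_mul_realPeriodRat_eq_plusPeriod
  have hX₀ : D.IsTorsion := hWu.isTorsion W₀ p hp2 hmult₀ hred₀ hκ hγ hγ' Dm.isNewformOf D ϖ hϖ
  obtain ⟨S₀, hS₀, hSV, hSW⟩ := exists_finset_badPlaces_away V W₀ p
  exact ⟨hX₀, X2.CongruentLambdaShiftMultiplicative.mu_eq_zero_mult_of_mult V W₀ S₀ hT hT' hAm hBm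
    hF hp2 hmultV hmult₀ hκ hγ hS₀ hSV hSW hiso.symm DV D hXV hX₀ hμV⟩

/-- **A GOOD-ORDINARY congruent partner with `μ′_an = 0` gives `μ(X(W₀/ℚ_∞)) = 0`** (the mixed
direction; by the predecessor file a good partner of a SPLIT X2b curve is an anomalous `ClassX1`
curve, of a NON-split one a covered type-A pair). `W₀` multiplicative at the odd `p` with `W₀[p]`
reducible, `V` good ordinary at `p`, `TorsionIso W₀ V p`, `X1.MuPart.AnalyticMuLE V p 0`. Inputs by
name: Wuthrich Thm. 16 at `p ∤ N` (`hW16`) and `p ‖ N` (`hWu`), modularity, Tate uniformisation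
(`hT`, `hT'`), GV (5)–(7) at `p ‖ N` (`hAm`), GV p. 26 / (7) / Prop. (2.5) (`hGV`, `hA`, `hB`); the
transfer is the tree's `mu_eq_zero_mult_of_goodOrd`.
[cite: GreenbergVatsal2000, Thm. (1.4), §2 Prop. (2.8) and pp. 26–27] [cite: Wuthrich2014, Thm. 16 (p. 397)] -/
theorem forall_isTorsion_and_mu_eq_zero_of_torsionIso_goodOrd
    (hW16 : Wuthrich2014.charIdeal_dvd_padicLFunction)
    (hWu : Wuthrich2014.thm16_charIdeal_dvd_multiplicative_of_reducible)
    (hmod : nonempty_modularParametrizationData)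
    (hT : Silverman1994_thmV53_corV54_tateUniformisation.{0})
    (hT' : Silverman1994_thmV53_tateUniformisation.{0})
    (hAm : lambda_nonPrimitive_eq_add_sum_delta_multiplicative)
    (hGV : imKummer_ge_greenbergCondition_at_p) (hA : lambda_nonPrimitive_eq_add_sum_delta)
    (hB : divisible_nonPrimitiveSelmerInfty_of_mu_eq_zero)
    (hp2 : p ≠ 2) (hmult₀ : W₀.HasMultiplicativeReductionAtPrime p)
    (hred₀ : ¬ W₀.HasIrreducibleModPGaloisRep p)
    (hgoodV : V.HasGoodReductionAtPrime p) (hordV : ¬ (p : ℤ) ∣ V.frobeniusTrace p)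
    (hiso : TorsionIso W₀ V p) (hV : AnalyticMuLE V p 0)
    {κ : ZpExtension ℚ p} {γ : Field.absoluteGaloisGroup ℚ}
    (hκ : κ.IsCyclotomic) (hγ : κ.IsTopGenerator γ) (hγ' : IsCyclotomicVariable p γ)
    (D : W₀.SelmerDualData κ γ) : D.IsTorsion ∧ D.mu = 0 := by
  haveI : NeZero (W₀.conductorNorm ℤ) := ⟨(W₀.conductorNorm_pos_holds).ne'⟩
  haveI : NeZero (V.conductorNorm ℤ) := ⟨(V.conductorNorm_pos_holds).ne'⟩
  have hredV : ¬ V.HasIrreducibleModPGaloisRep p := by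
    intro hirr
    obtain ⟨e, he⟩ := hiso.symm
    exact hred₀ (hasIrreducibleModPGaloisRep_of_torsionIso e he hirr)
  obtain ⟨DV⟩ := V.nonempty_selmerDualData_holds κ γ hγ
  haveI : Module.Finite (IwasawaAlgebra p) D.X := D.module_finite_holds hγ
  haveI : Module.Finite (IwasawaAlgebra p) DV.X := DV.module_finite_holds hγ
  have hμV : DV.mu = 0 :=
    mu_eq_zero_of_analyticMuLE_zero hW16 hmod hp2 hgoodV hordV hredV hV hκ hγ hγ' DV
  have hXV : DV.IsTorsion :=
    (isTorsion_and_exists_factorisation hW16 hmod hp2 hgoodV hordV hredV hκ hγ hγ' DV).1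
  obtain ⟨Dm⟩ := hmod W₀
  obtain ⟨ϖ, -, hϖ, -⟩ := Dm.exists_rat_mul_realPeriodRat_eq_plusPeriod
  have hX₀ : D.IsTorsion := hWu.isTorsion W₀ p hp2 hmult₀ hred₀ hκ hγ hγ' Dm.isNewformOf D ϖ hϖ
  obtain ⟨S₀, hS₀, hSW, hSV⟩ := exists_finset_badPlaces_away W₀ V p
  exact ⟨hX₀, X2.CongruentLambdaShiftMultiplicative.mu_eq_zero_mult_of_goodOrd W₀ V S₀ hT hT' hAm hGV
    hA hB hp2 hmult₀ hgoodV hordV hκ hγ hS₀ hSW hSV hiso D DV hX₀ hXV hμV⟩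

/-! ## §2 Under Mazur's main conjecture at `(W,p)`: `μ_an = 0` ⟺ `μ(X(W/ℚ_∞)) = 0`; hence (T) -/

/-- Bookkeeping: a nonzero `G ∈ Λ` with `μ(G) = 0` and `ι(G) = F` exhibits a coefficient of `F` of
norm `1 > p⁻¹` (unit content, Greenberg–Vatsal (2)). [cite: GreenbergVatsal2000, p. 2, (2)] -/
theorem exists_lt_norm_coeff_of_mu_eq_zero {G : IwasawaAlgebra p} (hG0 : G ≠ 0) (hμ : mu G = 0)
    {F : PowerSeries ℚ_[p]} (hι : iwasawaToPowerSeries p G = F) :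
    ∃ k : ℕ, (p : ℝ) ^ (-(((0 : ℕ) : ℤ) + 1)) < ‖PowerSeries.coeff k F‖ := by
  have hpP : p.Prime := Fact.out
  have hndvd : ¬ PowerSeries.C (p : ℤ_[p]) ∣ G := by
    intro hdvd
    have h1 : 1 ≤ mu G := le_mu_of_C_pow_dvd hG0 (by rw [pow_one]; exact hdvd)
    omega
  obtain ⟨n, hn⟩ := (hasUnitContent_iff_exists_norm_coeff_map_eq_one G).mp
    ((hasUnitContent_iff_not_C_dvd G).mpr hndvd)
  refine ⟨n, ?_⟩
  rw [← hι, hn, Nat.cast_zero, zero_add, zpow_neg, zpow_one]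
  exact inv_lt_one_of_one_lt₀ (by exact_mod_cast hpP.one_lt)

/-- **Under Mazur's main conjecture at a multiplicative pair, Greenberg's `μ = 0` gives `μ_an = 0`**
(no divisibility fact needed): `X2.MazurMainConjectureAt W p` gives `char X = (g)` and
`ι(T·g·w) = ϖ·L` (split) resp. `ι(g·w) = ϖ·L` (non-split) with `w ∈ Λˣ`; `g ≠ 0` (`char X ≠ 0` over
the domain `Λ`, `Module.charIdeal_ne_bot`), `μ(g) = μ(X) = 0` by (G), `μ(T) = μ(w) = 0`, so the
displayed element has `μ = 0` and unit content: a coefficient of `ϖ·L` is a `p`-adic unit.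
[cite: GreenbergVatsal2000, p. 2 (1)–(2)] [cite: MazurTateTeitelbaum1986, §I.14 (shape)] -/
theorem analyticMuLE_zero_of_mazurMainConjectureAt_of_forall_mu_eq_zero {W : WeierstrassCurve ℚ}
    [W.IsElliptic] [W.IsGloballyMinimal] (hMC : X2.MazurMainConjectureAt W p)
    (hG : ∀ (κ : ZpExtension ℚ p) (γ : Field.absoluteGaloisGroup ℚ),
      κ.IsCyclotomic → κ.IsTopGenerator γ → IsCyclotomicVariable p γ →
      ∀ D : W.SelmerDualData κ γ, D.mu = 0) :
    X2.AnalyticMuLE W p 0 := by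
  intro N _ f hf ϖ hϖ L hLs hLn
  obtain ⟨κ, hκ, γ, hγ, hγ'⟩ := exists_isCyclotomic_isTopGenerator_isCyclotomicVariable_holds p
  obtain ⟨D⟩ := W.nonempty_selmerDualData_holds κ γ hγ
  haveI : Module.Finite (IwasawaAlgebra p) D.X := D.module_finite_holds hγ
  obtain ⟨hD, g, hchar, hsplit, hnonsplit⟩ := hMC κ γ hκ hγ hγ' f hf D ϖ hϖ
  have hg0 : g ≠ 0 := by
    intro h0
    apply Literature.NumberTheory.EllipticCurves.Module.charIdeal_ne_bot (IwasawaAlgebra p) D.X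
    change D.charIdeal = ⊥
    rw [hchar, h0, Ideal.span_singleton_eq_bot]
  have hμg : mu g = 0 := by
    have h0 := hG κ γ hκ hγ hγ' D
    rw [SelmerDualData.mu] at h0
    rw [mu_generator_eq_muInvariant D.X hD hg0 hchar, h0]
  have hX0 : (PowerSeries.X : IwasawaAlgebra p) ≠ 0 := PowerSeries.X_ne_zero
  by_cases hs : W.HasSplitMultiplicativeReductionAtPrime p
  · obtain ⟨w, hw⟩ := hsplit hs L (hLs hs)
    refine exists_lt_norm_coeff_of_mu_eq_zero (mul_ne_zero (mul_ne_zero hX0 hg0) w.ne_zero) ?_ hw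
    rw [mu_mul (mul_ne_zero hX0 hg0) w.ne_zero, mu_mul hX0 hg0, X2.mu_X_eq_zero_and_pfree_X.1, hμg,
      X2.mu_eq_zero_of_isUnit w.isUnit]
  · obtain ⟨w, hw⟩ := hnonsplit hs L (hLn hs)
    refine exists_lt_norm_coeff_of_mu_eq_zero (mul_ne_zero hg0 w.ne_zero) ?_ hw
    rw [mu_mul hg0 w.ne_zero, hμg, X2.mu_eq_zero_of_isUnit w.isUnit]

/-- **Under Mazur's main conjecture at a multiplicative Eisenstein pair (`p ≠ 2`): `μ_an = 0 ⟺
μ(X(E/ℚ_∞)) = 0`** for every cyclotomic dual datum (⇒: Kato–Wuthrich, `hWu` + modularity; ⇐: the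
previous theorem). So at an X2b pair the crux `X2.MazurMainConjectureAt` carries exactly the μ-PART of
the road's transfer (T); what is left of (T) is Greenberg's `μ = 0`, which §1 moves along `E[p] ≅ E′[p]`.
[cite: Wuthrich2014, Thm. 16 (p. 397)] [cite: GreenbergVatsal2000, p. 2 (1)–(2)] -/
theorem analyticMuLE_zero_iff_forall_mu_eq_zero_of_mazurMainConjectureAt {W : WeierstrassCurve ℚ}
    [W.IsElliptic] [W.IsGloballyMinimal]
    (hWu : Wuthrich2014.thm16_charIdeal_dvd_multiplicative_of_reducible)
    (hmod : nonempty_modularParametrizationData) (hp2 : p ≠ 2)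
    (hmult : W.HasMultiplicativeReductionAtPrime p) (hred : ¬ W.HasIrreducibleModPGaloisRep p)
    (hMC : X2.MazurMainConjectureAt W p) :
    X2.AnalyticMuLE W p 0 ↔ ∀ (κ : ZpExtension ℚ p) (γ : Field.absoluteGaloisGroup ℚ),
      κ.IsCyclotomic → κ.IsTopGenerator γ → IsCyclotomicVariable p γ →
      ∀ D : W.SelmerDualData κ γ, D.mu = 0 :=
  ⟨fun h _ _ hκ hγ hγ' D ↦
      (X2.isTorsion_and_mu_eq_zero_of_analyticMuLE_zero hWu hmod hp2 hmult hred h hκ hγ hγ' D).2,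
    analyticMuLE_zero_of_mazurMainConjectureAt_of_forall_mu_eq_zero hMC⟩

/-- **Under the crux, the road's transfer (T) holds at every X2b target, multiplicative partner.**
If Mazur's main conjecture holds at every X2b pair (verbatim the conclusion predicate
`X2.MazurMainConjectureAt` of the crux `MazurMCOnCellB`, stated without importing the route file),
then for every X2b curve `W₀` (on or off the locus) and every multiplicative `V` with `W₀[p] ≅ V[p]`:
`X2.AnalyticMuLE V p 0 ⇒ X2.AnalyticMuLE W₀ p 0`. So (T) is no stronger than the crux: the road is
CONSISTENT, and CIRCULAR — its one unprinted step is the crux's own μ-part.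
[cite: GreenbergVatsal2000, Thm. (1.4), p. 4 and p. 27] [cite: Wuthrich2014, Thm. 16 (p. 397)] -/
theorem transfer_of_mazurMCOnCellB_mult
    (hWu : Wuthrich2014.thm16_charIdeal_dvd_multiplicative_of_reducible)
    (hmod : nonempty_modularParametrizationData)
    (hT : Silverman1994_thmV53_corV54_tateUniformisation.{0})
    (hT' : Silverman1994_thmV53_tateUniformisation.{0})
    (hAm : lambda_nonPrimitive_eq_add_sum_delta_multiplicative)
    (hBm : datumSelmer_divisible_of_finite_torsionBy) (hF : datumStrictSelmer_lt_datumSelmer_of_split)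
    (hMC : ∀ (W : WeierstrassCurve ℚ) [W.IsElliptic] [W.IsGloballyMinimal] (p : ℕ) [Fact p.Prime],
      X2.CellB W p → X2.MazurMainConjectureAt W p)
    (hc : X2.CellB W₀ p) (hmultV : V.HasMultiplicativeReductionAtPrime p) (hiso : TorsionIso W₀ V p)
    (hV : X2.AnalyticMuLE V p 0) : X2.AnalyticMuLE W₀ p 0 :=
  analyticMuLE_zero_of_mazurMainConjectureAt_of_forall_mu_eq_zero (hMC W₀ p hc)
    fun _ _ hκ hγ hγ' D ↦ (forall_isTorsion_and_mu_eq_zero_of_torsionIso_mult hWu hmod hT hT' hAm hBm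
      hF hc.2.1.1 hc.2.1.2.2 hc.2.1.2.1 hmultV hiso hV hκ hγ hγ' D).2

/-- **Under the crux, the road's transfer (T) holds at every X2b target, good-ordinary partner**
(the mixed direction: X2b target, `ClassX1` / covered partner with `X1.MuPart.AnalyticMuLE V p 0`).
[cite: GreenbergVatsal2000, Thm. (1.4), p. 4 and p. 27] [cite: Wuthrich2014, Thm. 16 (p. 397)] -/
theorem transfer_of_mazurMCOnCellB_goodOrd (hW16 : Wuthrich2014.charIdeal_dvd_padicLFunction)
    (hWu : Wuthrich2014.thm16_charIdeal_dvd_multiplicative_of_reducible)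
    (hmod : nonempty_modularParametrizationData)
    (hT : Silverman1994_thmV53_corV54_tateUniformisation.{0})
    (hT' : Silverman1994_thmV53_tateUniformisation.{0})
    (hAm : lambda_nonPrimitive_eq_add_sum_delta_multiplicative)
    (hGV : imKummer_ge_greenbergCondition_at_p) (hA : lambda_nonPrimitive_eq_add_sum_delta)
    (hB : divisible_nonPrimitiveSelmerInfty_of_mu_eq_zero)
    (hMC : ∀ (W : WeierstrassCurve ℚ) [W.IsElliptic] [W.IsGloballyMinimal] (p : ℕ) [Fact p.Prime],
      X2.CellB W p → X2.MazurMainConjectureAt W p)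
    (hc : X2.CellB W₀ p) (hgoodV : V.HasGoodReductionAtPrime p) (hordV : ¬ (p : ℤ) ∣ V.frobeniusTrace p)
    (hiso : TorsionIso W₀ V p) (hV : AnalyticMuLE V p 0) : X2.AnalyticMuLE W₀ p 0 :=
  analyticMuLE_zero_of_mazurMainConjectureAt_of_forall_mu_eq_zero (hMC W₀ p hc)
    fun _ _ hκ hγ hγ' D ↦ (forall_isTorsion_and_mu_eq_zero_of_torsionIso_goodOrd hW16 hWu hmod hT hT'
      hAm hGV hA hB hc.2.1.1 hc.2.1.2.2 hc.2.1.2.1 hgoodV hordV hiso hV hκ hγ hγ' D).2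

/-! ## §3 The registered stub under the crux: stub ⇐ crux ∧ (S″) -/

/-- **The stub supplies its own partner**: `stub_analyticMuZero_offLocus` (on -19033) ⇒ (S″) with
`V := W₀` multiplicative and `E[p] ≅ E[p]` — (S″) is a weakening of the stub. [folklore] -/
theorem partnerSupply_of_stub
    (hstub : ∀ (W₀ : WeierstrassCurve ℚ) [W₀.IsElliptic] [W₀.IsGloballyMinimal] (p : ℕ) [Fact p.Prime],
      X2.CellB W₀ p → ¬ HasRamifiedOddLineAt W₀ p → X2.AnalyticMuLE W₀ p 0) :
    ∀ (W₀ : WeierstrassCurve ℚ) [W₀.IsElliptic] [W₀.IsGloballyMinimal] (p : ℕ) [Fact p.Prime],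
      X2.CellB W₀ p → ¬ HasRamifiedOddLineAt W₀ p →
      ∃ (V : WeierstrassCurve ℚ) (_ : V.IsElliptic) (_ : V.IsGloballyMinimal), TorsionIso W₀ V p ∧
        ((V.HasMultiplicativeReductionAtPrime p ∧ X2.AnalyticMuLE V p 0) ∨
          (V.HasGoodReductionAtPrime p ∧ ¬ (p : ℤ) ∣ V.frobeniusTrace p ∧ AnalyticMuLE V p 0)) := by
  intro W₀ _ _ p _ hc hoff
  exact ⟨W₀, ‹_›, ‹_›, torsionIso_refl W₀ p, Or.inl ⟨hc.2.1.2.2, hstub W₀ p hc hoff⟩⟩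

/-- **`stub_analyticMuZero_offLocus` (on -19033) FROM THE CRUX AND A PARTNER SUPPLY (S″)**: if Mazur's
main conjecture holds at every X2b pair and every off-locus X2b curve has an `E[p]`-congruent partner —
multiplicative with `X2.AnalyticMuLE V p 0`, or good ordinary with `X1.MuPart.AnalyticMuLE V p 0` —
then the registered stub holds (verbatim signature as conclusion). Reading: along the congruence road
the crux `MazurMCOnCellB` and its own stub differ exactly by «Greenberg's `μ = 0` at the étale end,
movable along `E[p] ≅ E′[p]`» — the road changes WHERE `μ = 0` must be certified, never WHETHER the
μ-part of the main conjecture must be proved. [cite: GreenbergVatsal2000, Thm. (1.4), p. 4 and p. 27]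
[cite: GreenbergLNM1716, Conj. 1.11] [cite: Wuthrich2014, Thm. 16 (p. 397)] -/
theorem stub_of_mazurMCOnCellB_of_partnerSupply (hW16 : Wuthrich2014.charIdeal_dvd_padicLFunction)
    (hWu : Wuthrich2014.thm16_charIdeal_dvd_multiplicative_of_reducible)
    (hmod : nonempty_modularParametrizationData)
    (hT : Silverman1994_thmV53_corV54_tateUniformisation.{0})
    (hT' : Silverman1994_thmV53_tateUniformisation.{0})
    (hAm : lambda_nonPrimitive_eq_add_sum_delta_multiplicative)
    (hBm : datumSelmer_divisible_of_finite_torsionBy) (hF : datumStrictSelmer_lt_datumSelmer_of_split)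
    (hGV : imKummer_ge_greenbergCondition_at_p) (hA : lambda_nonPrimitive_eq_add_sum_delta)
    (hB : divisible_nonPrimitiveSelmerInfty_of_mu_eq_zero)
    (hMC : ∀ (W : WeierstrassCurve ℚ) [W.IsElliptic] [W.IsGloballyMinimal] (p : ℕ) [Fact p.Prime],
      X2.CellB W p → X2.MazurMainConjectureAt W p)
    (hS : ∀ (W₀ : WeierstrassCurve ℚ) [W₀.IsElliptic] [W₀.IsGloballyMinimal] (p : ℕ) [Fact p.Prime],
      X2.CellB W₀ p → ¬ HasRamifiedOddLineAt W₀ p →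
      ∃ (V : WeierstrassCurve ℚ) (_ : V.IsElliptic) (_ : V.IsGloballyMinimal), TorsionIso W₀ V p ∧
        ((V.HasMultiplicativeReductionAtPrime p ∧ X2.AnalyticMuLE V p 0) ∨
          (V.HasGoodReductionAtPrime p ∧ ¬ (p : ℤ) ∣ V.frobeniusTrace p ∧ AnalyticMuLE V p 0))) :
    ∀ (W₀ : WeierstrassCurve ℚ) [W₀.IsElliptic] [W₀.IsGloballyMinimal] (p : ℕ) [Fact p.Prime],
      X2.CellB W₀ p → ¬ HasRamifiedOddLineAt W₀ p → X2.AnalyticMuLE W₀ p 0 := by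
  intro W₀ _ _ p _ hc hoff
  obtain ⟨V, _, _, hiso, hV⟩ := hS W₀ p hc hoff
  -- enter the binders of `X2.AnalyticMuLE` (its implicit level binders are consumed eagerly otherwise)
  intro N _ f hf ϖ hϖ L hLs hLn
  rcases hV with ⟨hmultV, hV⟩ | ⟨hgoodV, hordV, hV⟩
  · exact transfer_of_mazurMCOnCellB_mult hWu hmod hT hT' hAm hBm hF hMC hc hmultV hiso hV f hf ϖ hϖ L
      hLs hLn
  · exact transfer_of_mazurMCOnCellB_goodOrd hW16 hWu hmod hT hT' hAm hGV hA hB hMC hc hgoodV hordV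
      hiso hV f hf ϖ hϖ L hLs hLn

end Summit.BirchSwinnertonDyer.BirchSwinnertonDyer.Theorems.EisensteinPrimesMazurMCOnCellBCongruenceRoadMuPart

end
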